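import Summits.CriticalPhenomena.SAWScalingLimit.Theses.SAWDefectDecoherence

/-!
# Skeleton line `two-root-quotient` for crux `BoundaryClosureR` (stmt-CriticalPhenomena-14004; planned under the retired id stmt-CriticalPhenomena-8536 `BoundaryClosure`)

Route `SAWDefectDecoherence`, crux r4
`BoundaryClosureR := DefectDecoherence → MassRatio → HexObservableLimitR` — the boundary
Riemann–Hilbert half of Duminil-Copin–Smirnov's Conjecture 2, given the route's two exponent
cruxes, over the REPAIRED target `HexObservableLimitR` (root pinned conformally: for both marked
points the domain is the half-plane piece `{im z > im (pt i)}` inside `ball (pt i) ρ` and `Λ δ` is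
the exact half-lattice `{v | m i δ ≤ v.1 1}` there).

## History of the target (read first)

This unit was armed on `BoundaryClosure` (stmt-8536) = `DefectDecoherence → MassRatio →
HexObservableLimit`.  During the session the conclusion `HexObservableLimit` (stmt-5420) was
REFUTED (`Theorems/SAWDefectDecoherenceHexObservableLimitRefutation.lean`, corridor witness:
the root `a δ` was tied to `D.pt 0` only Euclideanly; class `refuted-misstated`), the route went
BROKEN (2026-08-15T23:46Z) — as typed `BoundaryClosure ↔ ¬(DefectDecoherence ∧ MassRatio)`, so no
honest line could conclude it (the three triagers' §G1/§0) — and was REPAIRED at 2026-08-16T00:00Z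
(rev 15): `HexObservableLimitR` (stmt-14003), `BoundaryClosureR` (stmt-14004).  The skeleton below
concludes the LIVE decl `BoundaryClosureR` BY NAME; every statement pins every root and the
normaliser conformally (`PinnedFlatRoot`), which is exactly what the corridor witness violates.

## The line (idea `two-root-quotient`, ideator 3; triage r1: 3 × pass, sign of `RootRatioLaw` fixed)

LEVER: run the observable from TWO pinned roots and divide.  On every boundary mid-edge the
quotient `F^{x}/F^{x'}` has lattice-factor-free modulus `Z_x/Z_{x'}` and EXACTLY two-valued phase
(`TwoRootArcConstancy`, stub 1), so the quotient of the limits solves a Riemann–Hilbert problem with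
piecewise-constant argument on an ARBITRARY rough boundary, which is rigid:
`g_{x'} = (1 - Φ/t)^{-5/4} g_x` (`RootRatioLaw`, stub 4, from stubs 1 + 3 = the two-root boundary
Harnack principle `RatioContinuity`).  NEW CLOSING (this plan; replaces the idea card's staircase
`CellLaw`, which is NOT needed): all auxiliary roots live on the flat piece `I` around `b = D.pt 1`,
where dangling edges are conformally pinned for free.  With `r_x(y) := lim Z_x(y_δ)/Z_x(b_δ)` and
`κ_x` the blow-up constant of `g_x` at its root,
* covariance (stub 4) gives `‖κ_x‖ = |t_x/Φ'(x)|^{5/4} ‖g_a(x)‖` and `r_x(y) = |1-t_y/t_x|^{-5/4} r_a(y)`;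
* `FlatLocality` (stub 5: two pinned flat roots see the same half-lattice, so their blow-ups agree
  up to the normalisations) gives `‖κ_x‖ = μ(x',x) ‖κ_{x'}‖`, `μ = lim Z_{x'}(b_δ)/Z_x(b_δ)`;
* RECIPROCITY `Z_x(y_δ) = Z_y(x_δ)` (exact: reverse the walk) gives `μ(y,x) = r_x(y)/r_y(x)`;
whence `r_a(x)² / |Φ'(x)|^{5/4}` is constant along `I`, i.e. `‖g_a‖ = |K| |Φ'/Φ'(b)|^{5/8}` on `I`
(`FlatTrace`, stub 6, supplies `‖g_x(y)‖ = |K| r_x(y)` with ONE universal boundary-layer constant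
`K` and constant phase along `I`).  So `G := g_a · exp(-(5/8)(L - L_b))` has the constant boundary
value `K` on the straight arc `I`; Schwarz reflection + identity theorem give `G ≡ K` on `Ω`:
`g_a = K · exp((5/8)(L - L_b))` with `c := K` universal (`Identification`, delivered by stub 7 =
the closing argument).  The rough part of `∂Ω` is touched only through the EXACT two-valued phase;
Kennedy–Lawler class factors never appear (same target edge for both roots).  Compactness,
non-vanishing and the root/flat-point regularity of subsequential limits are the companion line's
deliverable (`three-eighths-cup-harnack`), imported here as ONE stub (`stub_cupLimits`, the
hardest).  `closing` (sorry-free, this file) turns `CupLimits + Identification` into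
`HexObservableLimitR` by the subsequence principle; `BoundaryClosureR_of` is the kernel-checked
composition concluding the crux by name.

## Disproof / negatives used
* `Disproof.lean` (payload path under run/gate, NOT mounted in this jail; its notes read from the
  item's evidence list): its main finding (¬HOL, corridor) is honoured by construction — every
  statement below pins every root and the normaliser conformally (`PinnedFlatRoot`), and nothing
  reads a conformal position off a Euclidean limit alone.
* Landed negatives checked: `SAWDefectDecoherenceHexObservableLimit_refuted` and its supports
  `BoundaryClosure.Negative.*` (corridor family on the half-disc): no stub is an instance — every
  stub is either corridor-invariant (bounds / ratios / exact lattice identities) or quantifies only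
  over pinned roots, and the conclusion is the repaired `HexObservableLimitR`.  `ledger negatives` (8): 0772 (all-δ tightness) —
  everything here is eventual/along sequences; 8312 (one constant over disconnected supports) — the
  only universal constants asserted are `K` (boundary layer at a pinned flat point) and `c := K`.
-/

noncomputable section

open scoped BigOperators ComplexConjugate Topology
open Filter Set MeasureTheory
open Literature.Probability.LatticeModels Literature.Probability.RandomPlanarGeometry
open Literature.Probability.RandomPlanarGeometry.SAW
open Summit.CriticalPhenomena.SAWScalingLimit.Theses.SAWDefectDecoherence

namespace Summit.CriticalPhenomena.SAWScalingLimit.Cruxes.BoundaryClosure.TwoRootQuotient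

/-! ### 1. Vocabulary shared by the stubs -/

/-- The normalised functional `N^{e}_δ(ψ) := δ² Σ_{z ∈ Ω_δ} ψ(δ·mid z) F^{e δ}(z) / F^{e δ}(b δ)`
(root family `e`, normalisation family `b`, spin `5/8`, fugacity `x_c`). -/
def NF (Λ : ℝ → Finset HexVertex) (e b : ℝ → Sym2 HexVertex) (δ : ℝ) (ψ : ℂ → ℂ) : ℂ :=
  (δ : ℂ) ^ 2 * (∑ᶠ z ∈ hexDomainMidEdges (Λ δ),
      ψ ((δ : ℂ) * hexMidpoint z) * hexParafermionicObservable (Λ δ) (e δ) hexCriticalFugacity (5 / 8) z) /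
    hexParafermionicObservable (Λ δ) (e δ) hexCriticalFugacity (5 / 8) (b δ)

/-- The arrival mass `Z^{e δ}(z) = F_{x_c, 0}(z) ≥ 0` (the spin-`0` observable is a nonnegative real;
we take its norm). -/
def arrivalMass (Λ : ℝ → Finset HexVertex) (e : ℝ → Sym2 HexVertex) (δ : ℝ) (z : Sym2 HexVertex) : ℝ :=
  ‖hexParafermionicObservable (Λ δ) (e δ) hexCriticalFugacity 0 z‖

/-- Bulk test functions of the target: continuous, compactly supported inside the domain. -/
def IsTest (D : DobrushinDomain) (ψ : ℂ → ℂ) : Prop :=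
  Continuous ψ ∧ HasCompactSupport ψ ∧ tsupport ψ ⊆ D.carrier

/-- The root-free part of the target's hypotheses: flat piece and exact half-lattice around the
normalisation point `D.pt 1`, eventual admissibility of `Λ δ`, exhaustion of compacts, `b δ → pt 1`. -/
def AdmissibleFamily (D : DobrushinDomain) (ρ : ℝ) (Λ : ℝ → Finset HexVertex) (m : ℝ → ℤ)
    (b : ℝ → Sym2 HexVertex) : Prop :=
  0 < ρ ∧
  D.carrier ∩ Metric.ball (D.pt 1) ρ = {z : ℂ | (D.pt 1).im < z.im} ∩ Metric.ball (D.pt 1) ρ ∧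
  (∀ᶠ δ : ℝ in 𝓝[>] 0, hexDomainSimplyConnected (Λ δ) ∧ b δ ∈ hexDomainBoundary (Λ δ) ∧
      (hexGraph.induce ((Λ δ : Finset HexVertex) : Set HexVertex)).Preconnected ∧
      (∀ v ∈ Λ δ, (δ : ℂ) * hexCenter v ∈ D.carrier) ∧
      (∀ v : HexVertex, (δ : ℂ) * hexCenter v ∈ Metric.ball (D.pt 1) ρ → (v ∈ Λ δ ↔ m δ ≤ v.1 1))) ∧
  (∀ K : Set ℂ, IsCompact K → K ⊆ D.carrier →
      ∀ᶠ δ : ℝ in 𝓝[>] 0, ∀ v : HexVertex, (δ : ℂ) * hexCenter v ∈ K → v ∈ Λ δ) ∧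
  Tendsto (fun δ : ℝ => (δ : ℂ) * hexMidpoint (b δ)) (𝓝[>] 0) (𝓝 (D.pt 1))

/-- A root family `e` PINNED on a flat piece at `x ∈ ∂D`: inside `ball x r` the domain is the open
half-plane above `x` and `Λ δ` is exactly the half-lattice `{v | mr δ ≤ v.1 1}`; the roots are
boundary mid-edges with `δ·mid(e δ) → x`, and walks to the normaliser exist.  (The same predicate
describes the target's root at `D.pt 0`, the normaliser at `D.pt 1`, and the auxiliary roots on the
flat piece `I` around `D.pt 1` used by the closing argument.) -/
def PinnedFlatRoot (D : DobrushinDomain) (Λ : ℝ → Finset HexVertex) (b : ℝ → Sym2 HexVertex)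
    (x : ℂ) (e : ℝ → Sym2 HexVertex) (r : ℝ) (mr : ℝ → ℤ) : Prop :=
  0 < r ∧
  D.carrier ∩ Metric.ball x r = {z : ℂ | x.im < z.im} ∩ Metric.ball x r ∧
  (∀ᶠ δ : ℝ in 𝓝[>] 0, e δ ∈ hexDomainBoundary (Λ δ) ∧ Nonempty (HexMidEdgeSAW (Λ δ) (e δ) (b δ)) ∧
      (∀ v : HexVertex, (δ : ℂ) * hexCenter v ∈ Metric.ball x r → (v ∈ Λ δ ↔ mr δ ≤ v.1 1))) ∧
  Tendsto (fun δ : ℝ => (δ : ℂ) * hexMidpoint (e δ)) (𝓝[>] 0) (𝓝 x)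

/-- `g` is the weak limit of the normalised functionals of root family `e` along the mesh sequence
`ns`: `N^{e}_{ns n}(ψ) → ∫ ψ g` for every bulk test function. -/
def IsWeakLimit (D : DobrushinDomain) (Λ : ℝ → Finset HexVertex) (e b : ℝ → Sym2 HexVertex)
    (ns : ℕ → ℝ) (g : ℂ → ℂ) : Prop :=
  ∀ ψ : ℂ → ℂ, IsTest D ψ → Tendsto (fun n => NF Λ e b (ns n) ψ) atTop (𝓝 (∫ z, ψ z * g z))

/-- The flat boundary points seen by a root pinned at `x` (radius `r`): the normaliser's flat piece
`I = {im = im (pt 1)} ∩ ball (pt 1) ρ` and the root's own flat piece. -/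
def flatPoints (D : DobrushinDomain) (ρ : ℝ) (x : ℂ) (r : ℝ) : Set ℂ :=
  ({z : ℂ | z.im = (D.pt 1).im} ∩ Metric.ball (D.pt 1) ρ) ∪ ({z : ℂ | z.im = x.im} ∩ Metric.ball x r)

/-- What the companion cup line delivers about a subsequential limit density `g` of a root pinned at
`x`: holomorphic and zero-free on the domain, blow-up of exact order `5/4` at its own root (the
cup's apex angle `π/4`), and non-zero boundary values at every other flat boundary point. -/
def IsCupLimit (D : DobrushinDomain) (ρ : ℝ) (x : ℂ) (r : ℝ) (g : ℂ → ℂ) : Prop :=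
  DifferentiableOn ℂ g D.carrier ∧ (∀ z ∈ D.carrier, g z ≠ 0) ∧
  (∃ κ : ℂ, κ ≠ 0 ∧ Tendsto (fun z => g z * (z - x) ^ ((5 : ℂ) / 4)) (𝓝[D.carrier] x) (𝓝 κ)) ∧
  (∀ y ∈ flatPoints D ρ x r, y ≠ x → ∃ w : ℂ, w ≠ 0 ∧ Tendsto g (𝓝[D.carrier] y) (𝓝 w))

/-! ### 2. The seven statements of the line -/

/-- STUB 1 statement (exact lattice lemma, provable now from the Umlaufsatz machinery of
`BoundaryWindingRigidity`, stmt-8515): for a simply connected `Λ`, two boundary roots `a = {u₁,w₁}`,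
`a' = {u₂,w₂}` and two further boundary mid-edges `e = {u₃,w₃}`, `e' = {u₄,w₄}` (all four
distinct), the difference of windings `W_a(e) − W_{a'}(e)` changes from `e` to `e'` by `0` or `±2π`
only.  Hence `F_a/F_{a'}` has lattice-factor-free modulus `Z_a/Z_{a'}` and exactly two-valued phase
on every boundary, however rough.  (Verbatim `Ideator3Sketch.TwoRootArcConstancy`; toy-checked on
394 + all root pairs of the triagers' enumerations, 0 violations.) -/
def TwoRootArcConstancy : Prop :=
  ∀ (Λ : Finset HexVertex), hexDomainSimplyConnected Λ →
    ∀ (u₁ w₁ u₂ w₂ u₃ w₃ u₄ w₄ : HexVertex),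
      hexGraph.Adj u₁ w₁ → u₁ ∉ Λ → w₁ ∈ Λ → hexGraph.Adj u₂ w₂ → u₂ ∉ Λ → w₂ ∈ Λ →
      hexGraph.Adj u₃ w₃ → u₃ ∉ Λ → w₃ ∈ Λ → hexGraph.Adj u₄ w₄ → u₄ ∉ Λ → w₄ ∈ Λ →
      List.Pairwise (· ≠ ·) [s(u₁, w₁), s(u₂, w₂), s(u₃, w₃), s(u₄, w₄)] →
    ∀ (γ₁ : HexMidEdgeSAW Λ s(u₁, w₁) s(u₃, w₃)) (γ₂ : HexMidEdgeSAW Λ s(u₂, w₂) s(u₃, w₃))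
      (γ₃ : HexMidEdgeSAW Λ s(u₁, w₁) s(u₄, w₄)) (γ₄ : HexMidEdgeSAW Λ s(u₂, w₂) s(u₄, w₄)),
      ∃ k : ℤ, (k = 0 ∨ k = 1 ∨ k = -1) ∧
        (γ₁.winding - γ₂.winding) - (γ₃.winding - γ₄.winding) = 2 * Real.pi * k

/-- STUB 2 conclusion (the companion cup line, imported whole): for every admissible family and
every pinned flat root other than the normalisation point, every mesh sequence has a subsequence
along which the normalised functionals converge weakly to a cup limit (holomorphic, zero-free,
order-`5/4` blow-up at the root, non-zero boundary values at the other flat points). -/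
def CupLimits : Prop :=
  ∀ (D : DobrushinDomain) (ρ : ℝ) (Λ : ℝ → Finset HexVertex) (m : ℝ → ℤ) (b : ℝ → Sym2 HexVertex),
    AdmissibleFamily D ρ Λ m b →
  ∀ (x : ℂ) (e : ℝ → Sym2 HexVertex) (r : ℝ) (mr : ℝ → ℤ),
    PinnedFlatRoot D Λ b x e r mr → x ≠ D.pt 1 →
  ∀ ns : ℕ → ℝ, Tendsto ns atTop (𝓝[>] 0) →
    ∃ ms : ℕ → ℕ, StrictMono ms ∧ ∃ g : ℂ → ℂ, IsCupLimit D ρ x r g ∧ IsWeakLimit D Λ e b (ns ∘ ms) g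

/-- STUB 3 statement — the two-root boundary Harnack principle (positive in spirit, stated in the
division-free determinant form the Riemann–Hilbert step consumes): near every boundary point `p`
other than the two (pinned, flat) roots, the observables from the two roots are asymptotically
PROPORTIONAL as functions of the target mid-edge (bulk or boundary) ON EVERY LOCALLY CONNECTED PIECE
`S` of `Λ δ` inside the ball — the Kennedy–Lawler class factor of a boundary target cancels because
the target is the same for both roots.  (Local connectivity is essential: a dead-end corridor
attached far from `p` carries the ratio of its attachment point, cf. the corridor refutation.) -/
def RatioContinuity : Prop :=
  ∀ (D : DobrushinDomain) (ρ : ℝ) (Λ : ℝ → Finset HexVertex) (m : ℝ → ℤ) (b : ℝ → Sym2 HexVertex),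
    AdmissibleFamily D ρ Λ m b →
  ∀ (x : ℂ) (e : ℝ → Sym2 HexVertex) (r : ℝ) (mr : ℝ → ℤ)
    (x' : ℂ) (e' : ℝ → Sym2 HexVertex) (r' : ℝ) (mr' : ℝ → ℤ),
    PinnedFlatRoot D Λ b x e r mr → PinnedFlatRoot D Λ b x' e' r' mr' → x ≠ x' →
  ∀ p ∈ frontier D.carrier, p ≠ x → p ≠ x' →
  ∀ ε : ℝ, 0 < ε → ∃ s : ℝ, 0 < s ∧ ∀ᶠ δ : ℝ in 𝓝[>] 0,
    ∀ S : Finset HexVertex, S ⊆ Λ δ → (∀ v ∈ S, (δ : ℂ) * hexCenter v ∈ Metric.ball p s) →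
      (hexGraph.induce ((S : Finset HexVertex) : Set HexVertex)).Preconnected →
    ∀ z ∈ hexDomainMidEdges (Λ δ), ∀ z' ∈ hexDomainMidEdges (Λ δ),
      (∃ v ∈ z, v ∈ S) → (∃ v ∈ z', v ∈ S) →
      ‖hexParafermionicObservable (Λ δ) (e δ) hexCriticalFugacity (5 / 8) z *
            hexParafermionicObservable (Λ δ) (e' δ) hexCriticalFugacity (5 / 8) z' -
          hexParafermionicObservable (Λ δ) (e δ) hexCriticalFugacity (5 / 8) z' *
            hexParafermionicObservable (Λ δ) (e' δ) hexCriticalFugacity (5 / 8) z‖ ≤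
        ε * (‖hexParafermionicObservable (Λ δ) (e δ) hexCriticalFugacity (5 / 8) z‖ *
              ‖hexParafermionicObservable (Λ δ) (e' δ) hexCriticalFugacity (5 / 8) z'‖ +
            ‖hexParafermionicObservable (Λ δ) (e δ) hexCriticalFugacity (5 / 8) z'‖ *
              ‖hexParafermionicObservable (Λ δ) (e' δ) hexCriticalFugacity (5 / 8) z‖)

/-- STUB 4 conclusion — the root-ratio law (two-root Riemann–Hilbert rigidity; sign as corrected by
all three triagers: the pole sits at the auxiliary root): for the target's root `a` pinned at
`D.pt 0` (`Φ → ∞` there) and an auxiliary root `e` pinned at a flat boundary point `x` with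
`Φ`-boundary value `t ≠ 0`, any pair of cup limits reached along a COMMON mesh sequence satisfies
`g' = (1 - Φ/t)^{-5/4} · g` on the domain (principal power: `1 - Φ/t` never meets the real axis). -/
def RootRatioLaw : Prop :=
  ∀ (D : DobrushinDomain) (ρ : ℝ) (Λ : ℝ → Finset HexVertex) (m : ℝ → ℤ) (b : ℝ → Sym2 HexVertex),
    AdmissibleFamily D ρ Λ m b →
  ∀ (a : ℝ → Sym2 HexVertex) (r₀ : ℝ) (m₀ : ℝ → ℤ), PinnedFlatRoot D Λ b (D.pt 0) a r₀ m₀ →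
  ∀ (Φ : ConformalEquiv D.carrier UpperHalfPlane.upperHalfPlaneSet),
    Tendsto (fun z => ‖Φ z‖) (𝓝[D.carrier] (D.pt 0)) atTop → Φ.HasBoundaryValue (D.pt 1) 0 →
  ∀ (x : ℂ) (e : ℝ → Sym2 HexVertex) (r : ℝ) (mr : ℝ → ℤ) (t : ℝ),
    PinnedFlatRoot D Λ b x e r mr → Φ.HasBoundaryValue x t → t ≠ 0 →
  ∀ ns : ℕ → ℝ, Tendsto ns atTop (𝓝[>] 0) →
  ∀ g g' : ℂ → ℂ,
    IsCupLimit D ρ (D.pt 0) r₀ g → IsWeakLimit D Λ a b ns g →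
    IsCupLimit D ρ x r g' → IsWeakLimit D Λ e b ns g' →
    ∀ z ∈ D.carrier, g' z = (1 - Φ z / (t : ℂ)) ^ (-(5 : ℂ) / 4) * g z

/-- STUB 5 statement — flat-root locality (two pinned flat roots see the same exact half-lattice, so
their blow-up constants agree up to the normalisations): along a common mesh sequence,
`‖κ‖ = μ ‖κ'‖` where `μ = lim Z_{x'}(b_δ)/Z_x(b_δ)` is the limiting ratio of the two root-to-
normaliser arrival masses.  (Consistent with Conjecture 2: both sides transform covariantly; the
absolute input that the cell law used to supply.) -/
def FlatLocality : Prop :=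
  ∀ (D : DobrushinDomain) (ρ : ℝ) (Λ : ℝ → Finset HexVertex) (m : ℝ → ℤ) (b : ℝ → Sym2 HexVertex),
    AdmissibleFamily D ρ Λ m b →
  ∀ (x : ℂ) (e : ℝ → Sym2 HexVertex) (r : ℝ) (mr : ℝ → ℤ)
    (x' : ℂ) (e' : ℝ → Sym2 HexVertex) (r' : ℝ) (mr' : ℝ → ℤ),
    PinnedFlatRoot D Λ b x e r mr → PinnedFlatRoot D Λ b x' e' r' mr' → x ≠ D.pt 1 → x' ≠ D.pt 1 →
  ∀ ns : ℕ → ℝ, Tendsto ns atTop (𝓝[>] 0) →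
  ∀ (g g' : ℂ → ℂ) (κ κ' : ℂ) (μ : ℝ),
    IsWeakLimit D Λ e b ns g → IsWeakLimit D Λ e' b ns g' →
    Tendsto (fun z => g z * (z - x) ^ ((5 : ℂ) / 4)) (𝓝[D.carrier] x) (𝓝 κ) →
    Tendsto (fun z => g' z * (z - x') ^ ((5 : ℂ) / 4)) (𝓝[D.carrier] x') (𝓝 κ') →
    Tendsto (fun n => arrivalMass Λ e' (ns n) (b (ns n)) / arrivalMass Λ e (ns n) (b (ns n)))
      atTop (𝓝 μ) →
    ‖κ‖ = μ * ‖κ'‖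

/-- STUB 6 statement — the flat trace with ONE universal boundary-layer constant `K ≠ 0`: for a cup
limit `g` of a pinned flat root `x ≠ pt 1`, (i) its boundary value at the normalisation point is
`K`; (ii) at every point `y ≠ x` of the flat piece `I` around `pt 1`, approached by boundary
mid-edges `ey δ`, the arrival-mass ratios `Z_x(ey_δ)/Z_x(b_δ)` converge to `‖w‖/‖K‖`, `w` the
boundary value of `g` at `y`; (iii) if the root's ball misses the normaliser's, the phase of `w` is
that of `K` (rigid winding is constant along `I`). -/
def FlatTrace : Prop :=
  ∃ K : ℂ, K ≠ 0 ∧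
  ∀ (D : DobrushinDomain) (ρ : ℝ) (Λ : ℝ → Finset HexVertex) (m : ℝ → ℤ) (b : ℝ → Sym2 HexVertex),
    AdmissibleFamily D ρ Λ m b →
  ∀ (x : ℂ) (e : ℝ → Sym2 HexVertex) (r : ℝ) (mr : ℝ → ℤ), PinnedFlatRoot D Λ b x e r mr → x ≠ D.pt 1 →
  ∀ ns : ℕ → ℝ, Tendsto ns atTop (𝓝[>] 0) →
  ∀ g : ℂ → ℂ, IsCupLimit D ρ x r g → IsWeakLimit D Λ e b ns g →
    Tendsto g (𝓝[D.carrier] (D.pt 1)) (𝓝 K) ∧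
    ∀ (y : ℂ) (ey : ℝ → Sym2 HexVertex) (w : ℂ),
      y.im = (D.pt 1).im → y ∈ Metric.ball (D.pt 1) ρ → y ≠ x →
      (∀ᶠ δ : ℝ in 𝓝[>] 0, ey δ ∈ hexDomainBoundary (Λ δ)) →
      Tendsto (fun δ : ℝ => (δ : ℂ) * hexMidpoint (ey δ)) (𝓝[>] 0) (𝓝 y) →
      Tendsto g (𝓝[D.carrier] y) (𝓝 w) →
      Tendsto (fun n => arrivalMass Λ e (ns n) (ey (ns n)) / arrivalMass Λ e (ns n) (b (ns n)))
          atTop (𝓝 (‖w‖ / ‖K‖)) ∧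
        (Disjoint (Metric.ball x r) (Metric.ball (D.pt 1) ρ) → w = K * ((‖w‖ / ‖K‖ : ℝ) : ℂ))

/-- STUB 7 conclusion — identification of every subsequential cup limit of the TARGET's root with
ONE universal constant: `g = c · exp((5/8)(L - L_b))` on the domain. -/
def Identification : Prop :=
  ∃ c : ℂ, c ≠ 0 ∧
  ∀ (D : DobrushinDomain) (ρ : ℝ) (Λ : ℝ → Finset HexVertex) (m : ℝ → ℤ) (b : ℝ → Sym2 HexVertex),
    AdmissibleFamily D ρ Λ m b →
  ∀ (a : ℝ → Sym2 HexVertex) (r₀ : ℝ) (m₀ : ℝ → ℤ), PinnedFlatRoot D Λ b (D.pt 0) a r₀ m₀ →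
  ∀ (Φ : ConformalEquiv D.carrier UpperHalfPlane.upperHalfPlaneSet) (L : ℂ → ℂ) (Lb : ℂ),
    Tendsto (fun z => ‖Φ z‖) (𝓝[D.carrier] (D.pt 0)) atTop → Φ.HasBoundaryValue (D.pt 1) 0 →
    ContinuousOn L D.carrier → (∀ z ∈ D.carrier, Complex.exp (L z) = deriv Φ z) →
    Tendsto L (𝓝[D.carrier] (D.pt 1)) (𝓝 Lb) →
  ∀ ns : ℕ → ℝ, Tendsto ns atTop (𝓝[>] 0) →
  ∀ g : ℂ → ℂ, IsCupLimit D ρ (D.pt 0) r₀ g → IsWeakLimit D Λ a b ns g →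
    ∀ z ∈ D.carrier, g z = c * Complex.exp ((5 / 8 : ℂ) * (L z - Lb))

/-! ### 3. The registered stubs (the only `sorry`s of the file) -/

/-- STUB 1 (M; provable now): two-root arc constancy of the rigid windings. -/
theorem stub_twoRootArcConstancy : TwoRootArcConstancy := by
  sorry

/-- STUB 2 (XL; the companion line `three-eighths-cup-harnack` entire — compactness from the
degree-one cup, univalence in measure from `DefectDecoherence` + `MassRatio` at the cut `3/4`,
apex/flat-point regularity): the route's two exponent cruxes give cup limits. HARDEST. -/
theorem stub_cupLimits : DefectDecoherence → MassRatio → CupLimits := by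
  sorry

/-- STUB 3 (L; open, positive-mass in spirit): the two-root boundary Harnack principle. -/
theorem stub_ratioContinuity : RatioContinuity := by
  sorry

/-- STUB 4 (L): Riemann–Hilbert rigidity of the quotient — exact two-valued boundary phase (stub 1)
and proportionality near the rough boundary (stub 3) pin `g'/g = (1 - Φ/t)^{-5/4}`; the orders at
the two roots come from the cup-limit clauses. -/
theorem stub_rootRatioLaw : TwoRootArcConstancy → RatioContinuity → RootRatioLaw := by
  sorry

/-- STUB 5 (L; open): flat-root locality. -/
theorem stub_flatLocality : FlatLocality := by
  sorry

/-- STUB 6 (L; open): flat trace with a universal boundary-layer constant. -/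
theorem stub_flatTrace : FlatTrace := by
  sorry

/-- STUB 7 (L; classical analysis given stubs 2, 4, 5, 6): the closing argument — covariance
blow-ups, reciprocity `Z_x(y_δ) = Z_y(x_δ)` (reverse the walk), locality, hence
`‖g_a‖ = |K| |Φ'/Φ'(b)|^{5/8}` with constant phase on the flat arc, then Schwarz reflection and the
identity theorem. -/
theorem stub_closingArgument :
    CupLimits → RootRatioLaw → FlatLocality → FlatTrace → Identification := by
  sorry

/-! ### Name-keyed aliases of the seven stub statements (hypotheses of the composition)

`Registered.stub_X` is the statement of `stub_X` under the registered stub's short name, so that the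
native skeleton audit (`#h21_check_skeleton`: hypotheses admissible iff registered obligations /
declared stubs BY NAME) accepts `BoundaryClosureR_of : Registered.stub_… → … → BoundaryClosureR` (same device
as `Cruxes/LagHandOff/Lines/crosscut-dictionary.lean`). -/
namespace Registered

/-- Alias keyed by the registered stub name. -/
abbrev stub_twoRootArcConstancy : Prop := TwoRootArcConstancy
/-- Alias keyed by the registered stub name. -/
abbrev stub_cupLimits : Prop := DefectDecoherence → MassRatio → CupLimits
/-- Alias keyed by the registered stub name. -/
abbrev stub_ratioContinuity : Prop := RatioContinuity
/-- Alias keyed by the registered stub name. -/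
abbrev stub_rootRatioLaw : Prop := TwoRootArcConstancy → RatioContinuity → RootRatioLaw
/-- Alias keyed by the registered stub name. -/
abbrev stub_flatLocality : Prop := FlatLocality
/-- Alias keyed by the registered stub name. -/
abbrev stub_flatTrace : Prop := FlatTrace
/-- Alias keyed by the registered stub name. -/
abbrev stub_closingArgument : Prop :=
  CupLimits → RootRatioLaw → FlatLocality → FlatTrace → Identification

end Registered

/-! ### 4. The sorry-free part: subsequence principle and the composition -/

/-- **Closing step (no `sorry`)**: cup limits along subsequences of every mesh sequence
(`CupLimits`) and their identification with one universal constant (`Identification`) give the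
pinned target, by `Filter.tendsto_of_subseq_tendsto` on the countably generated filter `𝓝[>] 0`. -/
theorem closing (hC : CupLimits) (hI : Identification) : HexObservableLimitR := by
  obtain ⟨c, hc, hId⟩ := hI
  refine ⟨c, hc, ?_⟩
  intro D ρ Λ m a b Φ L Lb ψ F hρ hflat hadm hexh ha hb hΦ hΦb hL hexpL hLb hψc hψK hψD
  -- repackage the hypotheses
  have hAF : AdmissibleFamily D ρ Λ (m 1) b := by
    refine ⟨hρ, hflat 1, ?_, hexh, hb⟩
    filter_upwards [hadm] with δ hδ
    exact ⟨hδ.1, hδ.2.2.1, hδ.2.2.2.2.1, hδ.2.2.2.2.2.1, hδ.2.2.2.2.2.2 1⟩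
  have hPR : PinnedFlatRoot D Λ b (D.pt 0) a ρ (m 0) := by
    refine ⟨hρ, hflat 0, ?_, ha⟩
    filter_upwards [hadm] with δ hδ
    exact ⟨hδ.2.1, hδ.2.2.2.1, hδ.2.2.2.2.2.2 0⟩
  have h01 : D.pt 0 ≠ D.pt 1 := fun h => absurd (D.pt_injective h) (by decide)
  have hψ : IsTest D ψ := ⟨hψc, hψK, hψD⟩
  -- the subsequence principle on the countably generated filter `𝓝[>] 0`
  refine Filter.tendsto_of_subseq_tendsto fun ns hns => ?_
  obtain ⟨ms, hms, g, hg, hw⟩ := hC D ρ Λ (m 1) b hAF (D.pt 0) a ρ (m 0) hPR h01 ns hns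
  have hns' : Tendsto (ns ∘ ms) atTop (𝓝[>] 0) := hns.comp hms.tendsto_atTop
  have hid : ∀ z ∈ D.carrier, g z = c * Complex.exp ((5 / 8 : ℂ) * (L z - Lb)) :=
    hId D ρ Λ (m 1) b hAF a ρ (m 0) hPR Φ L Lb hΦ hΦb hL hexpL hLb (ns ∘ ms) hns' g hg hw
  -- the limit density is `c · exp((5/8)(L - Lb))` on the domain and `ψ` vanishes off the domain
  have hint : ∫ z, ψ z * g z = c * ∫ z, ψ z * Complex.exp ((5 / 8 : ℂ) * (L z - Lb)) := by
    rw [← integral_const_mul]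
    refine integral_congr_ae (Filter.Eventually.of_forall fun z => ?_)
    by_cases hz : z ∈ D.carrier
    · simp only [hid z hz]; ring
    · have hψz : ψ z = 0 := image_eq_zero_of_notMem_tsupport fun h => hz (hψD h)
      simp only [hψz, zero_mul, mul_zero]
  have key := hw ψ hψ
  rw [hint] at key
  exact ⟨ms, key⟩

/-- **The composition (kernel-checked, no `sorry`)**: the seven stubs imply the crux
`BoundaryClosureR` BY NAME.  Given the antecedents `DefectDecoherence`, `MassRatio`: STUB 2 turns them into cup limits;
STUB 4 (fed by STUBS 1, 3) is the root-ratio law; STUB 7 (fed by STUBS 2, 4, 5, 6) identifies every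
subsequential limit with the universal constant; `closing` concludes by the subsequence principle. -/
theorem BoundaryClosureR_of (h1 : Registered.stub_twoRootArcConstancy)
    (h2 : Registered.stub_cupLimits) (h3 : Registered.stub_ratioContinuity)
    (h4 : Registered.stub_rootRatioLaw) (h5 : Registered.stub_flatLocality)
    (h6 : Registered.stub_flatTrace) (h7 : Registered.stub_closingArgument) :
    Summit.CriticalPhenomena.SAWScalingLimit.Theses.SAWDefectDecoherence.BoundaryClosureR :=
  fun hDD hMR => closing (h2 hDD hMR) (h7 (h2 hDD hMR) (h4 h1 h3) h5 h6)

/-- Wiring check: the registered stubs feed `BoundaryClosureR_of` as stated. -/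
example : Summit.CriticalPhenomena.SAWScalingLimit.Theses.SAWDefectDecoherence.BoundaryClosureR :=
  BoundaryClosureR_of stub_twoRootArcConstancy stub_cupLimits stub_ratioContinuity
    stub_rootRatioLaw stub_flatLocality stub_flatTrace stub_closingArgument

end Summit.CriticalPhenomena.SAWScalingLimit.Cruxes.BoundaryClosure.TwoRootQuotient

end
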